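import Literature.NumberTheory.GaloisRepresentations.OrdinaryGaloisRep
import HarnessLib

/-!
# Ordinary, `p`-distinguished `GSp₄`-valued representations (Boxer–Calegari–Gee–Pilloni 2025, Def. 1.8.10)

Topic `Literature/NumberTheory/GaloisRepresentations`.  Vocabulary for the hypotheses "`ρ_{A,2}|_{G_{ℚ₂}}`
is ordinary and `2`-distinguished" of Boxer–Calegari–Gee–Pilloni, *Modularity theorems for abelian
surfaces* (arXiv:2502.20645), Thm. 8.3.2 and Lemma 9.4.2 (2)(b) (via Def. 9.1.2), needed to vendor those
two results (`Literature/NumberTheory/DiophantineGeometry/BcgpResiduallyA5bModular.lean`,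
`…/BcgpSwitchingSurface.lean`).

## The printed definition (loc. cit. §1.8.9 "Ordinary Galois representations", Definition 1.8.10)

(Numbering = arXiv v1: all numbered items of the paper share the subsubsection counter; checked
against the arXiv HTML rendering.)

"Let `K/ℚ_p` be a finite extension, and let `ρ : G_K → GSp₄(ℚ̄_p)` be a representation with
similitude factor `ε⁻¹`.  We say that `ρ` is *ordinary* if there are characters
`χ₁, χ₂ : G_K → ℚ̄_p^×` with
```
        ⎛ χ₁  *   *         *        ⎞
  ρ ≅   ⎜ 0   χ₂  *         *        ⎟ .
        ⎜ 0   0   ε⁻¹χ₂⁻¹   *        ⎟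
        ⎝ 0   0   0         ε⁻¹χ₁⁻¹ ⎠
```
We say that the ordered pair `(χ₁, χ₂)` is a *`p`-stabilization* of `ρ`.  We say that `ρ` is
*`p`-distinguished* if the 4 characters `χ₁, χ₂, ε⁻¹χ₂⁻¹, ε⁻¹χ₁⁻¹` are pairwise distinct.  We say that
`ρ` is *semistable of weight 2* if the subrepresentation `(χ₁ * ; 0 χ₂)` is unramified."

Here `ρ ≅ (…)` is an isomorphism of representations, i.e. `ρ` is `GL₄(ℚ̄_p)`-conjugate to a
homomorphism of the displayed upper-triangular (Borel) shape; NO unramifiedness is imposed on `χ₁, χ₂`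
in "ordinary" or in "`p`-distinguished" (that is the separate notion "semistable of weight 2"), and
distinctness is distinctness of `ℚ̄_p^×`-valued characters of `G_K` (NOT residual distinctness).

## What is here

* `FramedGaloisRep.IsOrdinaryPDistinguished ρ` for `ρ : Γ_F → GL₄(ℚ̄_p)` (`F` any field, intended
  `F = K_v`, `v ∣ p`; coefficients `PadicAlgCl p`): **ordinary AND `p`-distinguished** in the sense just
  quoted, in the COHOMOLOGICAL convention of the source (`ρ = ρ_{A,p} = H¹_ét(A, ℚ̄_p)`, similitude
  `ε⁻¹`): there are a frame `g ∈ GL₄(ℚ̄_p)` and characters `χ₁, χ₂ : Γ_F →* ℚ̄_p^×` such that every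
  `g⁻¹ ρ(τ) g` is upper triangular with diagonal `(χ₁(τ), χ₂(τ), ε(τ)⁻¹χ₂(τ)⁻¹, ε(τ)⁻¹χ₁(τ)⁻¹)`,
  `ε = GaloisRep.cyclotomicCharacter F p` read in `ℚ̄_p` along `ℤ_p ⊆ ℚ_p → ℚ̄_p` (the spelling of the
  accepted `IsWeightTwoOrdinaryDistinguished.dual_of_cohomological`), and the four diagonal entry
  functions `τ ↦ (g⁻¹ρ(τ)g)_{ii}`, `i = 0,…,3`, are pairwise distinct.
* `FramedGaloisRep.IsOrdinaryPDistinguishedAt ρ v` — the same for `ρ.toLocal v`, `ρ : Γ_K → GL₄(ℚ̄_p)`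
  global over a number field `K`, `v` a finite place (intended `v ∣ p`).
* API, all proved: the unfolding `isOrdinaryPDistinguishedAt_iff`, frame invariance
  `isOrdinaryPDistinguished_conj_iff` / `isOrdinaryPDistinguishedAt_conj_iff`, and
  `IsOrdinaryPDistinguished.exists_apply_ne` (distinctness of `χ₁, χ₂` yields some `τ` with
  `χ₁(τ) ≠ χ₂(τ)`), `IsOrdinaryPDistinguished.exists_borel` (the bare Borel clause).

## Relation to the neighbouring predicates (design note)

* `FramedGaloisRep.IsWeightTwoOrdinaryDistinguished` (`WeightTwoOrdinaryDistinguished.lean`) is the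
  2021 notion of Boxer–Calegari–Gee–Pilloni (Publ. IHÉS, Def. 7.3.1, "p-distinguished weight 2
  ordinary"): Siegel-parabolic shape with the two extra zeros, `χ₁, χ₂` UNRAMIFIED, and only
  `χ̄₁ ≠ χ̄₂` RESIDUALLY — and it is written in the homological convention.  The 2025 notion recorded
  here is different on all three counts (Borel shape, no unramifiedness, all four characters distinct
  in characteristic `0`); at `p = 2`, where `ε̄` is trivial, residual distinctness of `χ̄₁` and
  `ε̄⁻¹χ̄₁⁻¹` typically fails while distinctness in characteristic `0` holds, which is why the 2025
  paper (whose §8 is `2`-adic) uses the characteristic-`0` notion.  Neither predicate implies the other.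
* `GSp₄`- versus `GL₄`-conjugacy: the source's `ρ` is `GSp₄(ℚ̄_p)`-valued and "`≅`" is isomorphism of
  representations; the predicate here only asks for a `GL₄(ℚ̄_p)`-frame, which is what "`≅`" says.
  (For a `ρ` that is symplectic with multiplier `ε⁻¹` and `p`-distinguished the `Γ`-stable flag of the
  Borel frame is automatically isotropic, so nothing is lost; not needed, not formalised.)
* Characters are bare monoid homomorphisms `Γ_F →* ℚ̄_p^×` (the entries of a continuous `ρ` in a
  fixed frame are automatically continuous; not imposed, as in the sibling file).

## References

* G. Boxer, F. Calegari, T. Gee, V. Pilloni, *Modularity theorems for abelian surfaces*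
  (arXiv:2502.20645v1, 2025): §1.8.9, Definition 1.8.10 (ordinary; `p`-stabilization; `p`-distinguished;
  semistable of weight 2; the residual versions); Def. 9.1.2 (an abelian surface `B/ℚ_p` with `T_pB`
  ordinary is `p`-distinguished iff `ρ_{B,p}` is); Thm. 8.3.2 hypothesis (3); §1.8.23 (`ρ_{A,p} = H¹`,
  multiplier `ε⁻¹`). [BoxerCalegariGeePilloni2025]
* G. Boxer, F. Calegari, T. Gee, V. Pilloni, *Abelian surfaces over totally real fields are potentially
  modular*, Publ. Math. IHÉS 134 (2021), §7.3 Def. 7.3.1 (the 2021 notion, for contrast). [BoxerEtAl2021]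
-/

noncomputable section

open scoped NumberField MatrixGroups Matrix
open Field IsDedekindDomain

namespace Literature.NumberTheory.GaloisRepresentations

/-! ### The local predicate -/

section Local

variable {F : Type*} [Field F] {p : ℕ} [Fact p.Prime]

namespace FramedGaloisRep

/-- **`ρ : Γ_F → GL₄(ℚ̄_p)` is ordinary and `p`-distinguished** (Boxer–Calegari–Gee–Pilloni 2025,
Def. 1.8.10, cohomological convention, similitude `ε⁻¹`; `F` a field, intended `F = K_v` with `v ∣ p`):
there are a frame `g ∈ GL₄(ℚ̄_p)` and characters `χ₁, χ₂ : Γ_F →* ℚ̄_p^×` (a "`p`-stabilization")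
such that for every `τ ∈ Γ_F` the matrix `g⁻¹ ρ(τ) g` is upper triangular with diagonal
`(χ₁(τ), χ₂(τ), ε(τ)⁻¹ χ₂(τ)⁻¹, ε(τ)⁻¹ χ₁(τ)⁻¹)` — "ordinary" — and the four diagonal characters
`τ ↦ (g⁻¹ ρ(τ) g)_{ii}` are pairwise distinct — "`p`-distinguished".  Here `ε(τ)⁻¹` is the image in
`ℚ̄_p` of the unit `(GaloisRep.cyclotomicCharacter F p τ)⁻¹ ∈ ℤ_pˣ`.  No unramifiedness of `χ₁, χ₂`
is required (that is the separate printed notion "semistable of weight 2"), and distinctness is in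
characteristic `0`, not residual (module docstring).
[cite: BoxerCalegariGeePilloni2025, §1.8.9 Definition 1.8.10 (ordinary, p-stabilization, p-distinguished)] -/
def IsOrdinaryPDistinguished (ρ : FramedGaloisRep F (PadicAlgCl p) 4) : Prop :=
  ∃ (g : Matrix.GeneralLinearGroup (Fin 4) (PadicAlgCl p))
    (χ₁ χ₂ : absoluteGaloisGroup F →* (PadicAlgCl p)ˣ),
    (∀ τ, (∀ i j : Fin 4, j < i → (g⁻¹ * ρ τ * g).val i j = 0) ∧
      (g⁻¹ * ρ τ * g).val 0 0 = χ₁ τ ∧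
      (g⁻¹ * ρ τ * g).val 1 1 = χ₂ τ ∧
      (g⁻¹ * ρ τ * g).val 2 2 =
        algebraMap ℚ_[p] (PadicAlgCl p)
          ((((GaloisRep.cyclotomicCharacter F p τ)⁻¹ : ℤ_[p]ˣ) : ℤ_[p]) : ℚ_[p]) *
            ((χ₂ τ)⁻¹ : (PadicAlgCl p)ˣ) ∧
      (g⁻¹ * ρ τ * g).val 3 3 =
        algebraMap ℚ_[p] (PadicAlgCl p)
          ((((GaloisRep.cyclotomicCharacter F p τ)⁻¹ : ℤ_[p]ˣ) : ℤ_[p]) : ℚ_[p]) *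
            ((χ₁ τ)⁻¹ : (PadicAlgCl p)ˣ)) ∧
    ∀ i j : Fin 4, i ≠ j →
      (fun τ => (g⁻¹ * ρ τ * g).val i i) ≠ (fun τ => (g⁻¹ * ρ τ * g).val j j)

/-- Ordinarity-and-`p`-distinguishedness does not depend on the frame: `P ρ P⁻¹` (`FramedRep.conj`)
satisfies it iff `ρ` does (frame `g` replaced by `P g`, resp. `P⁻¹ g`). [folklore] -/
theorem isOrdinaryPDistinguished_conj_iff (P : GL (Fin 4) (PadicAlgCl p))
    (ρ : FramedGaloisRep F (PadicAlgCl p) 4) :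
    IsOrdinaryPDistinguished (FramedRep.conj P ρ) ↔ IsOrdinaryPDistinguished ρ := by
  constructor
  · rintro ⟨g, χ₁, χ₂, hsh, hdist⟩
    have e : ∀ τ, (P⁻¹ * g)⁻¹ * ρ τ * (P⁻¹ * g) = g⁻¹ * FramedRep.conj P ρ τ * g := fun τ => by
      rw [FramedRep.conj_apply]; group
    refine ⟨P⁻¹ * g, χ₁, χ₂, fun τ => ?_, ?_⟩
    · rw [e]; exact hsh τ
    · simpa only [e] using hdist
  · rintro ⟨g, χ₁, χ₂, hsh, hdist⟩
    have e : ∀ τ, (P * g)⁻¹ * FramedRep.conj P ρ τ * (P * g) = g⁻¹ * ρ τ * g := fun τ => by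
      rw [FramedRep.conj_apply]; group
    refine ⟨P * g, χ₁, χ₂, fun τ => ?_, ?_⟩
    · rw [e]; exact hsh τ
    · simpa only [e] using hdist

/-- The bare Borel clause: an ordinary `p`-distinguished `ρ` is, in some frame, upper triangular with
first two diagonal characters `χ₁, χ₂` (forgetting the shape of the last two entries and the
distinctness). [folklore] -/
theorem IsOrdinaryPDistinguished.exists_borel {ρ : FramedGaloisRep F (PadicAlgCl p) 4}
    (h : IsOrdinaryPDistinguished ρ) :
    ∃ (g : Matrix.GeneralLinearGroup (Fin 4) (PadicAlgCl p))
      (χ₁ χ₂ : absoluteGaloisGroup F →* (PadicAlgCl p)ˣ),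
      ∀ τ, (∀ i j : Fin 4, j < i → (g⁻¹ * ρ τ * g).val i j = 0) ∧
        (g⁻¹ * ρ τ * g).val 0 0 = χ₁ τ ∧ (g⁻¹ * ρ τ * g).val 1 1 = χ₂ τ := by
  obtain ⟨g, χ₁, χ₂, hsh, -⟩ := h
  exact ⟨g, χ₁, χ₂, fun τ => ⟨(hsh τ).1, (hsh τ).2.1, (hsh τ).2.2.1⟩⟩

/-- `p`-distinguishedness in use: the `p`-stabilization `(χ₁, χ₂)` of an ordinary `p`-distinguished
`ρ` consists of two DISTINCT characters, i.e. `χ₁(τ) ≠ χ₂(τ)` for some `τ` (the case `i = 0`,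
`j = 1` of the distinctness clause, read through the diagonal entries). [folklore] -/
theorem IsOrdinaryPDistinguished.exists_apply_ne {ρ : FramedGaloisRep F (PadicAlgCl p) 4}
    (h : IsOrdinaryPDistinguished ρ) :
    ∃ (g : Matrix.GeneralLinearGroup (Fin 4) (PadicAlgCl p))
      (χ₁ χ₂ : absoluteGaloisGroup F →* (PadicAlgCl p)ˣ),
      (∀ τ, (g⁻¹ * ρ τ * g).val 0 0 = χ₁ τ ∧ (g⁻¹ * ρ τ * g).val 1 1 = χ₂ τ) ∧
        ∃ τ, (χ₁ τ : PadicAlgCl p) ≠ χ₂ τ := by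
  obtain ⟨g, χ₁, χ₂, hsh, hdist⟩ := h
  refine ⟨g, χ₁, χ₂, fun τ => ⟨(hsh τ).2.1, (hsh τ).2.2.1⟩, ?_⟩
  by_contra hne
  push Not at hne
  refine hdist 0 1 (by decide) (funext fun τ => ?_)
  simp only [(hsh τ).2.1, (hsh τ).2.2.1, hne τ]

end FramedGaloisRep

end Local

/-! ### At a finite place of a number field -/

section Global

variable {K : Type*} [Field K] [NumberField K] {p : ℕ} [Fact p.Prime]

namespace FramedGaloisRep

/-- **`ρ : Γ_K → GL₄(ℚ̄_p)` is ordinary and `p`-distinguished at the finite place `v`** of the number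
field `K` (intended `v ∣ p`): its restriction `ρ.toLocal v : Γ_{K_v} → GL₄(ℚ̄_p)` to the
decomposition group is `IsOrdinaryPDistinguished` — the hypothesis "`ρ_{A,p}|_{G_{ℚ_p}}` is ordinary
and `p`-distinguished" of Boxer–Calegari–Gee–Pilloni 2025, Thm. 8.3.2 (3) (`p = 2`), in the
cohomological convention.
[cite: BoxerCalegariGeePilloni2025, §1.8.9 Definition 1.8.10; Thm. 8.3.2 hypothesis (3)] -/
def IsOrdinaryPDistinguishedAt (ρ : FramedGaloisRep K (PadicAlgCl p) 4)
    (v : HeightOneSpectrum (𝓞 K)) : Prop :=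
  IsOrdinaryPDistinguished (ρ.toLocal v)

/-- Unfolding of `IsOrdinaryPDistinguishedAt` to the primitive vocabulary. [folklore] -/
theorem isOrdinaryPDistinguishedAt_iff (ρ : FramedGaloisRep K (PadicAlgCl p) 4)
    (v : HeightOneSpectrum (𝓞 K)) :
    IsOrdinaryPDistinguishedAt ρ v ↔
      ∃ (g : Matrix.GeneralLinearGroup (Fin 4) (PadicAlgCl p))
        (χ₁ χ₂ : absoluteGaloisGroup (v.adicCompletion K) →* (PadicAlgCl p)ˣ),
        (∀ τ, (∀ i j : Fin 4, j < i → (g⁻¹ * ρ.toLocal v τ * g).val i j = 0) ∧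
          (g⁻¹ * ρ.toLocal v τ * g).val 0 0 = χ₁ τ ∧
          (g⁻¹ * ρ.toLocal v τ * g).val 1 1 = χ₂ τ ∧
          (g⁻¹ * ρ.toLocal v τ * g).val 2 2 =
            algebraMap ℚ_[p] (PadicAlgCl p)
              ((((GaloisRep.cyclotomicCharacter (v.adicCompletion K) p τ)⁻¹ : ℤ_[p]ˣ) : ℤ_[p]) :
                ℚ_[p]) * ((χ₂ τ)⁻¹ : (PadicAlgCl p)ˣ) ∧
          (g⁻¹ * ρ.toLocal v τ * g).val 3 3 =
            algebraMap ℚ_[p] (PadicAlgCl p)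
              ((((GaloisRep.cyclotomicCharacter (v.adicCompletion K) p τ)⁻¹ : ℤ_[p]ˣ) : ℤ_[p]) :
                ℚ_[p]) * ((χ₁ τ)⁻¹ : (PadicAlgCl p)ˣ)) ∧
        ∀ i j : Fin 4, i ≠ j →
          (fun τ => (g⁻¹ * ρ.toLocal v τ * g).val i i) ≠
            (fun τ => (g⁻¹ * ρ.toLocal v τ * g).val j j) :=
  Iff.rfl

/-- Ordinarity-and-`p`-distinguishedness at `v` is invariant under a global change of frame
`ρ ↦ P ρ P⁻¹`. [folklore] -/
theorem isOrdinaryPDistinguishedAt_conj_iff (P : GL (Fin 4) (PadicAlgCl p))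
    (ρ : FramedGaloisRep K (PadicAlgCl p) 4) (v : HeightOneSpectrum (𝓞 K)) :
    IsOrdinaryPDistinguishedAt (FramedRep.conj P ρ) v ↔ IsOrdinaryPDistinguishedAt ρ v := by
  rw [IsOrdinaryPDistinguishedAt, toLocal_conj]
  exact isOrdinaryPDistinguished_conj_iff P (ρ.toLocal v)

end FramedGaloisRep

end Global

end Literature.NumberTheory.GaloisRepresentations
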